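import Summits.MatrixMultiplication.OmegaCensus.CyclicDihedralIndexTwoFamily
import HarnessLib

/-!
# A second (non-product) family attaining the `|A| ≡ 1 (mod 3)` law over `ℤ₂ × ℤ_{6k+2}`

ω-census `pub-omega`, family (b3), lead item G6-2 (seat ENG1 gen 4, 2026-08-21).
Framing: lottery ticket; floor = certified bounds/negative ranges.  VALUE = an explicit finite construction,
kernel-checked; NOT progress on ω, and NOT a new existence statement (see the next paragraph).

In a dihedral-like group of order `2|A|` over a finite abelian group `A` with `|A| ≡ 1 (mod 3)` every TPP triple has
`3|S||T||U| + 8 ≤ 8|A|` (`DihedralLikeLaw.lean`), and equality forces `A` to have an element of order `≥ |A|/2`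
whenever the 2-rank of `A` is at least 3 (`DihedralLawModOneRankThreeAll.no_mod_one_law_of_rank_three`; at `|A| = 64`
the remaining groups were closed by certified enumeration).  The converse is ALREADY in the tree: for cyclic `A` the
dihedral group attains the law (`dihedral_law`), and for the non-cyclic groups with an index-2 cyclic subgroup,
`A = ℤ₂ × ℤ_n` with `n ≡ 2 (mod 3)`, `C2DihedralLaw.c2_dihedral_law` gives `β(C₂ × D_{2n}) = 4⌊4n/3⌋`, the lower half
being the PRODUCT triple `(C₂, 1, 1) × (uniform dihedral family of D_{2n})` of `C2DihedralLowerBound.lean`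
(volume `8⌊2n/3⌋`, realizing `⟨4, 2, ⌊2n/3⌋⟩`; at `n = 32`: volume `168` in `C₂ × D₆₄ ≅ Dih(ℤ₂ × ℤ₃₂)`).

This file records a SECOND, explicit, non-product family with the same extremal volume (part sizes
`(1,1 | 2,2 | 2k, 2k+1)`, the "shape B" of `DihedralLawModOneShapeB.lean` up to the order of the sets; its 4-set has
four distinct `D_{2n}`-components, so it is not a translate of a product set `C₂ × X`) in `C₂ × D_{2n} ≅ Dih(ℤ₂ × ℤ_n)`,
`n = 6k + 2` (so `|A| = 2n = 12k + 4 ≡ 1 (mod 3)`), in the `rot`/`ref` calculus of `CyclicDihedralIndexTwoFamily.lean`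
(`Grp 2 n = Multiplicative (ZMod 2) × DihedralGroup n`, Mathlib's conventions `r i * sr j = sr (j - i)` etc.):

* `SB k = {(0, r 0), (0, sr 0)}`, `TB k = {(0, r 0), (0, r 1), (1, sr (4k+1)), (1, sr (4k+2))}`,
  `UB k = {(i, r i) : i < 2k} ∪ {(i, sr i) : 2k ≤ i ≤ 4k}` (first coordinates mod 2);
* `tpp_shapeB`: the triple has the triple product property (Cohn–Umans Def. 2.1, the tree's
  `TripleProductProperty`), for every `k ≥ 1`;
* `law_attained`: `3·|SB|·|TB|·|UB| + 8 = 3·2·4·(4k+1) + 8 = 8·(2n) = 8|A|`;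
* `exists_mod_one_law_triple_Z2xZ32`: the instance `k = 5` — a TPP triple of volume `168` in `C₂ × D₆₄ ≅ Dih(ℤ₂ × ℤ₃₂)`
  (order 128), `3·168 + 8 = 512 = 8·64`.

The same formula FAILS for odd `c = |U ∩ A|` (then `n` is odd and `ℤ₂ × ℤ_n` is cyclic); see the cell file
`code/eng1/results/shapeb-witness-Z2xZ32.json` for the search that found the pattern and five independent numerical
checks of the instance `n = 32`.
-/

namespace Summit.MatrixMultiplication.OmegaCensus.DihedralLawModOneIndexTwoAttained

open Literature.Computability.AlgebraicComplexity Literature.Combinatorics.Additive DihedralGroup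
open Summit.MatrixMultiplication.OmegaCensus.CyclicDihedralIndexTwoFamily

section family
variable (k : ℕ)

/-- `SB = {(0, r 0), (0, sr 0)} = {1, τ}` in `C₂ × D_{2(6k+2)}`. -/
def SB : Finset (Grp 2 (6 * k + 2)) :=
  {rot 2 (6 * k + 2) 0 0, ref 2 (6 * k + 2) 0 0}

/-- `TB = {(0, r 0), (0, r 1), (1, sr (4k+1)), (1, sr (4k+2))}`. -/
def TB : Finset (Grp 2 (6 * k + 2)) :=
  {rot 2 (6 * k + 2) 0 0, rot 2 (6 * k + 2) 0 1, ref 2 (6 * k + 2) 1 (4 * k + 1 : ℤ),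
    ref 2 (6 * k + 2) 1 (4 * k + 2 : ℤ)}

/-- `UB = {(i, r i) : i < 2k} ∪ {(i, sr i) : 2k ≤ i ≤ 4k}` (the "staircase"; first coordinates are read mod 2). -/
def UB : Finset (Grp 2 (6 * k + 2)) :=
  ((Finset.range (2 * k)).image fun i : ℕ => rot 2 (6 * k + 2) (i : ℤ) (i : ℤ)) ∪
  ((Finset.range (2 * k + 1)).image fun j : ℕ => ref 2 (6 * k + 2) (2 * k + j : ℤ) (2 * k + j : ℤ))

/-- `|SB k| = 2`. -/
theorem card_SB : (SB k).card = 2 := by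
  rw [SB, Finset.card_pair]
  simp

/-- `|TB k| = 4` (for `k ≥ 1`). -/
theorem card_TB (hk : 1 ≤ k) : (TB k).card = 4 := by
  have h1' : ¬ ((6 * (k : ℤ) + 2) ∣ 1) := by
    intro hd; have := Int.le_of_dvd one_pos hd; omega
  have h1 : ¬ ((((6 * k + 2 : ℕ)) : ℤ) ∣ 1) := by push_cast; exact h1'
  have d1 : rot 2 (6 * k + 2) 0 0 ≠ rot 2 (6 * k + 2) 0 1 := by
    rw [Ne, rot_eq_rot_iff]; push_cast; simp [h1']
  have d2 : rot 2 (6 * k + 2) 0 0 ≠ ref 2 (6 * k + 2) 1 (4 * k + 1 : ℤ) := by simp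
  have d3 : rot 2 (6 * k + 2) 0 0 ≠ ref 2 (6 * k + 2) 1 (4 * k + 2 : ℤ) := by simp
  have d4 : rot 2 (6 * k + 2) 0 1 ≠ ref 2 (6 * k + 2) 1 (4 * k + 1 : ℤ) := by simp
  have d5 : rot 2 (6 * k + 2) 0 1 ≠ ref 2 (6 * k + 2) 1 (4 * k + 2 : ℤ) := by simp
  have d6 : ref 2 (6 * k + 2) 1 (4 * k + 1 : ℤ) ≠ ref 2 (6 * k + 2) 1 (4 * k + 2 : ℤ) := by
    rw [Ne, ref_eq_ref_iff]
    intro h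
    obtain ⟨-, h2⟩ := h
    have e : (4 * (k : ℤ) + 2) - (4 * (k : ℤ) + 1) = 1 := by ring
    rw [e] at h2
    exact h1 h2
  simp only [TB]
  rw [Finset.card_insert_of_notMem (by simp only [Finset.mem_insert, Finset.mem_singleton]; push Not; exact ⟨d1, d2, d3⟩),
    Finset.card_insert_of_notMem (by simp only [Finset.mem_insert, Finset.mem_singleton]; push Not; exact ⟨d4, d5⟩),
    Finset.card_pair d6]

/-- `|UB k| = 4k + 1`. -/
theorem card_UB : (UB k).card = 4 * k + 1 := by
  have hM : (0 : ℤ) < ((6 * k + 2 : ℕ) : ℤ) := by positivity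
  rw [UB, Finset.card_union_of_disjoint, Finset.card_image_of_injOn, Finset.card_image_of_injOn,
    Finset.card_range, Finset.card_range]
  · omega
  · intro i hi i' hi' he
    simp only [Finset.coe_range, Set.mem_Iio] at hi hi'
    obtain ⟨-, hB⟩ := (ref_eq_ref_iff _ _ _ _).mp he
    rcases dvd_window2 hM hB (by push_cast; omega) (by push_cast; omega) with hB | hB | hB <;>
      (push_cast at hB; omega)
  · intro i hi i' hi' he
    simp only [Finset.coe_range, Set.mem_Iio] at hi hi'
    obtain ⟨-, hB⟩ := (rot_eq_rot_iff _ _ _ _).mp he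
    rcases dvd_window2 hM hB (by push_cast; omega) (by push_cast; omega) with hB | hB | hB <;>
      (push_cast at hB; omega)
  · rw [Finset.disjoint_left]
    intro x hx hx'
    simp only [Finset.mem_image, Finset.mem_range] at hx hx'
    obtain ⟨j, -, rfl⟩ := hx
    obtain ⟨i, -, hc⟩ := hx'
    simp at hc

set_option maxHeartbeats 4000000 in
/-- **The shape-B family has the triple product property** in `C₂ × D_{2(6k+2)}` for every `k ≥ 1`
(Cohn–Umans Def. 2.1: `s s'⁻¹ · t t'⁻¹ · u u'⁻¹ = 1` forces `s = s'`, `t = t'`, `u = u'`).  Proof: brute-force case split on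
the six memberships; each product is normalised by the `rot`/`ref` calculus to a pair of divisibility conditions
(`2 ∣ ·`, `6k+2 ∣ ·`), the second is windowed to finitely many multiples, and `omega` finishes. -/
theorem tpp_shapeB (hk : 1 ≤ k) :
    ∀ s ∈ SB k, ∀ s' ∈ SB k, ∀ t ∈ TB k, ∀ t' ∈ TB k, ∀ u ∈ UB k, ∀ u' ∈ UB k,
      s * s'⁻¹ * (t * t'⁻¹) * (u * u'⁻¹) = 1 → s = s' ∧ t = t' ∧ u = u' := by
  have hM : (0 : ℤ) < ((6 * k + 2 : ℕ) : ℤ) := by positivity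
  intro s hs s' hs' t ht t' ht' u hu u' hu' he
  simp only [SB, TB, UB, Finset.mem_image, Finset.mem_range, Finset.mem_union, Finset.mem_insert,
    Finset.mem_singleton] at hs hs' ht ht' hu hu'
  rcases hs with rfl | rfl <;> rcases hs' with rfl | rfl <;>
  rcases ht with rfl | rfl | rfl | rfl <;> rcases ht' with rfl | rfl | rfl | rfl <;>
  rcases hu with ⟨j, hj, rfl⟩ | ⟨j, hj, rfl⟩ <;> rcases hu' with ⟨j', hj', rfl⟩ | ⟨j', hj', rfl⟩ <;>
  simp only [rot_mul_rot, rot_mul_ref, ref_mul_rot, ref_mul_ref, rot_inv, ref_inv, rot_eq_one_iff,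
    ref_ne_one] at he
  all_goals (
    obtain ⟨hA, hB⟩ := he
    push_cast at hA
    rcases dvd_window6 hM hB (by omega) (by omega) with hB | hB | hB | hB | hB | hB | hB | hB | hB | hB | hB <;>
    first
      | (exfalso; omega)
      | (obtain rfl : j = j' := by omega
         exact ⟨rfl, rfl, rfl⟩))

/-- The family triple in the tree's vocabulary: `TripleProductProperty (SB k) (TB k) (UB k)` for `k ≥ 1`. -/
theorem tripleProductProperty_shapeB (hk : 1 ≤ k) : TripleProductProperty (SB k) (TB k) (UB k) :=
  tpp_shapeB k hk

/-- `C₂ × D_{2(6k+2)}` realizes `⟨2, 4, 4k+1⟩` through the shape-B family. -/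
theorem realizesTPP_shapeB (hk : 1 ≤ k) : RealizesTPP (Grp 2 (6 * k + 2)) 2 4 (4 * k + 1) :=
  ⟨SB k, TB k, UB k, card_SB k, card_TB k hk, card_UB k, tpp_shapeB k hk⟩

/-- `|C₂ × D_{2(6k+2)}| = 2 · (2(6k+2)) = 2|A|` with `A = ℤ₂ × ℤ_{6k+2}`. -/
theorem card_Grp_two : Fintype.card (Grp 2 (6 * k + 2)) = 2 * (2 * (6 * k + 2)) := by
  simp [Fintype.card_prod, ZMod.card, DihedralGroup.card]

/-- **The mod-one law is attained**: `3·|SB|·|TB|·|UB| + 8 = 8·|A|`, `|A| = 2(6k+2) = |ℤ₂ × ℤ_{6k+2}|` (`k ≥ 1`). -/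
theorem law_attained (hk : 1 ≤ k) :
    3 * ((SB k).card * (TB k).card * (UB k).card) + 8 = 8 * (2 * (6 * k + 2)) := by
  rw [card_SB, card_TB k hk, card_UB]; ring

/-- Existence form: for every `k ≥ 1` the group `C₂ × D_{2(6k+2)}` (the dihedral-like group with `c₀ = 0` over the
NON-cyclic `A = ℤ₂ × ℤ_{6k+2}`, `|A| ≡ 1 (mod 3)`) contains a TPP triple with `3|S||T||U| + 8 = 8|A| = 4|G|`. -/
theorem exists_mod_one_law_triple (hk : 1 ≤ k) : ∃ S T U : Finset (Grp 2 (6 * k + 2)),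
    TripleProductProperty S T U ∧ 3 * (S.card * T.card * U.card) + 8 = 4 * Fintype.card (Grp 2 (6 * k + 2)) :=
  ⟨SB k, TB k, UB k, tpp_shapeB k hk, by rw [law_attained k hk, card_Grp_two]; ring⟩

end family

/-- **G6-2 witness (`k = 5`)**: `C₂ × D₆₄ ≅ Dih(ℤ₂ × ℤ₃₂)` (order 128) contains a TPP triple of sizes `(2, 4, 21)`, volume
`168`, and `3·168 + 8 = 512 = 8·64 = 8|ℤ₂ × ℤ₃₂|` — an explicit non-product witness that the `|A| ≡ 1 (mod 3)` law is
attained over `ℤ₂ × ℤ₃₂` (the product witness of sizes `(4, 2, 21)` is `C2DihedralLaw.c2_dihedral_law` at `k = 32`). -/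
theorem exists_mod_one_law_triple_Z2xZ32 : ∃ S T U : Finset (Grp 2 32),
    TripleProductProperty S T U ∧ S.card = 2 ∧ T.card = 4 ∧ U.card = 21 ∧
      3 * (S.card * T.card * U.card) + 8 = 8 * 64 :=
  ⟨SB 5, TB 5, UB 5, tpp_shapeB 5 (by norm_num), card_SB 5, card_TB 5 (by norm_num), card_UB 5,
    by rw [card_SB, card_TB 5 (by norm_num), card_UB]⟩

/-- `|C₂ × D₆₄| = 128`. -/
theorem card_Grp_two_32 : Fintype.card (Grp 2 32) = 128 := by
  simp [Fintype.card_prod, ZMod.card, DihedralGroup.card]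

end Summit.MatrixMultiplication.OmegaCensus.DihedralLawModOneIndexTwoAttained
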